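import Mathlib
import Summits.NavierStokesRegularity.NavierStokesRegularity.Theorems.TaoLadderRungTwoBreakBlowupRigidityOneEnergyClimbing
import Summits.NavierStokesRegularity.NavierStokesRegularity.Theorems.TaoLadderRungTwoBreakBlowupRigidityOneCriticalBlowup
import HarnessLib

/-!
# NO SPONTANEOUS EMISSION ALONG A ROBUST BLOW-UP: the maximal exact flow of every `NoGlobalCascade` datum of a table in
  `E₂(R)` obeys `E_{>k}(t) ≤ (C_A Λ^k ∫₀ᵗ‖x_k‖²)²` and `‖x_{k+1}(t)‖ ≤ C_A Λ^k ∫₀ᵗ‖x_k‖²` on `[0,T⋆)` for every shell `k`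
  (K2(1) `TaoLadderRungTwoBreak.BlowupRigidityOne`, stmt-NavierStokesRegularity-20206: the pre-arrival side of the
  action ceiling (F2a) of the front bundle)

MODEL lattice ODEs only (Tao 2016 §4); nothing here is a statement about the Navier–Stokes equations; NO item is closed
(`--supports stmt-NavierStokesRegularity-20206`). Route-independent; general `m`; DEF-FREE. Packaging of
`tailEnergy_le_sq_action` / `norm_succ_le_action_sq` (p820487) with the maximal exact flow of a robust blow-up
(`criticalBlowup_of_noGlobalCascade`, g0-lineage).

* `energyClimbing_of_noGlobalCascade` — for `ε₀ > 0`, `α ∈ E₂(R)`, `NoGlobalCascade ε₀ α X₀`: the maximal exact flow `X` on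
  `[0,T⋆)` (C¹, one-shell datum at shell `0`, no shells below `0`, exact motion, (4.5)-regular before `T⋆`, critical
  amplitude unbounded) satisfies, for all `k ∈ ℕ` and `t ∈ [0,T⋆)`, the TAIL bound
  `Σᵢ X₀ᵢ² − Σ_{j≤k}‖x_j(t)‖² ≤ (C_A Λ^k ∫₀ᵗ‖x_k‖²)²` and the NEXT-SHELL bound `‖x_{k+1}(t)‖ ≤ C_A Λ^k ∫₀ᵗ‖x_k(s)‖² ds`.

HONEST LABEL: a-priori estimate; not the action ceiling; no stub, crux or summit is proved; rung 0.
-/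

noncomputable section

-- the summit and its single sub-problem share the name (CONVENTIONS §1)
set_option linter.dupNamespace false

open Set Filter Topology MeasureTheory intervalIntegral

namespace Summit.NavierStokesRegularity.NavierStokesRegularity.Theorems

namespace BlowupRigidityOne

open Literature.Analysis.FluidPDE Literature.Analysis.FluidPDE.TaoCascade

variable {m : ℕ}

/-- **ENERGY CLIMBING ALONG A ROBUST BLOW-UP.** [cite: Tao2016AveragedNS, §4 Thm. 4.2 (statement shape), (4.3), Lemma 4.1 (4.8)–(4.10), (4.12); §1.2] -/
theorem energyClimbing_of_noGlobalCascade {ε₀ R : ℝ} (hε : 0 < ε₀)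
    {α : Fin m → Fin m → Fin m → ℤ × ℤ × ℤ → ℝ} {X₀ : Fin m → ℝ} (hα : InTableClass R α)
    (hNG : NoGlobalCascade ε₀ α X₀) :
    ∃ (T : ℝ) (X : Fin m → ℤ → ℝ → ℝ), 0 < T ∧
      (∀ i n, ContDiffOn ℝ 1 (X i n) (Set.Ico 0 T)) ∧
      (∀ i n, X i n 0 = if n = 0 then X₀ i else 0) ∧
      (∀ i n t, n < 0 → X i n t = 0) ∧
      (∀ i n t, 0 ≤ t → t < T → derivWithin (X i n) (Set.Ici 0) t = quadTerm ε₀ α X i n t) ∧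
      (∀ T' : ℝ, 0 < T' → T' < T → ∃ M : ℝ, ∀ t : ℝ, 0 ≤ t → t ≤ T' →
        ∀ (i : Fin m) (n : ℤ), (1 + (1 + ε₀) ^ ((10 : ℝ) * n)) * |X i n t| ≤ M) ∧
      (∀ L : ℝ, ∃ t : ℝ, 0 ≤ t ∧ t < T ∧
        ∃ (i : Fin m) (k : ℤ), L < (1 + ε₀) ^ ((5 : ℝ) * k / 2) * |X i k t|) ∧
      (∀ (k : ℕ), ∀ t ∈ Ico (0 : ℝ) T,
        (∑ i, X₀ i ^ 2) - ∑ j ∈ Finset.range (k + 1), ‖shellVec X (j : ℤ) t‖ ^ 2 ≤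
          (fluxConst α * bigLam ε₀ ^ k * ∫ s in (0 : ℝ)..t, ‖shellVec X (k : ℤ) s‖ ^ 2) ^ 2) ∧
      (∀ (k : ℕ), ∀ t ∈ Ico (0 : ℝ) T,
        ‖shellVec X ((k : ℤ) + 1) t‖ ≤ fluxConst α * bigLam ε₀ ^ k * ∫ s in (0 : ℝ)..t, ‖shellVec X (k : ℤ) s‖ ^ 2) := by
  obtain ⟨T, X, hT, h1, h2, h3, h4, h5, h6⟩ := criticalBlowup_of_noGlobalCascade hε hα hNG
  have hder : ∀ i k, ∀ τ ∈ Ico (0 : ℝ) T,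
      HasDerivWithinAt (X i k) (quadTerm ε₀ α X i k τ) (Ici 0) τ := by
    intro i k τ hτ
    have hd : DifferentiableWithinAt ℝ (X i k) (Ico 0 T) τ :=
      ((h1 i k).differentiableOn one_ne_zero) τ hτ
    have hd' : DifferentiableWithinAt ℝ (X i k) (Ici 0) τ :=
      hd.mono_of_mem_nhdsWithin (by
        rw [mem_nhdsWithin]
        exact ⟨Iio T, isOpen_Iio, hτ.2, fun x hx => ⟨hx.2, hx.1⟩⟩)
    rw [← h4 i k τ hτ.1 hτ.2]
    exact hd'.hasDerivWithinAt
  have hreg : ∀ T' : ℝ, T' < T → ∃ M : ℝ, ∀ τ ∈ Icc (0 : ℝ) T', ∀ (i : Fin m) (k : ℤ),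
      (1 + (1 + ε₀) ^ ((10 : ℝ) * k)) * |X i k τ| ≤ M := by
    intro T' hT'
    rcases le_or_gt T' 0 with h0 | h0
    · obtain ⟨M, hM⟩ := h5 (T / 2) (by linarith) (by linarith)
      exact ⟨M, fun τ hτ i k => hM τ hτ.1 (by linarith [hτ.2]) i k⟩
    · obtain ⟨M, hM⟩ := h5 T' h0 hT'
      exact ⟨M, fun τ hτ i k => hM τ hτ.1 hτ.2 i k⟩
  exact ⟨T, X, hT, h1, h2, h3, h4, h5, h6,
    fun k => tailEnergy_le_sq_action hε hα.2.1 hder h2 h3 hreg k,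
    fun k => norm_succ_le_action_sq hε hα.2.1 hder h2 h3 hreg k⟩

end BlowupRigidityOne

end Summit.NavierStokesRegularity.NavierStokesRegularity.Theorems

end
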